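import Summits.KontsevichZagierPeriods.KontsevichZagierPeriods.Theorems.ReductionTwoSix.Negative.Tightness
import Summits.KontsevichZagierPeriods.KontsevichZagierPeriods.Theorems.DilationMove.Negative.TightnessAllDim

/-!
# `ReductionTwoSix` (stmt-KontsevichZagierPeriods-3871) — negative side VI: the stubs of line `jacobian-monomials`

Refuter (`drefute`) by-products, kernel-checked: load-bearing / tightness facts for the three registered
stubs of the picked line `jacobian-monomials` (skeleton 99b45435aafb) — all three stubs are TRUE as
registered (work file `Cruxes/ReductionTwoSix/DrefuteJacobianMonomials.md`); this file records what any
proof of them must use, over the landed kit (`ReductionTwoSix/Negative/Tightness`,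
`DilationMove/Negative/TightnessAllDim`):
* `stubBoxDilation_false_without_oneLe`: stub A (`stub_boxDilation` = the `n = 2` slice of `DilationMove`)
  is false with `1 ≤ m` deleted (`m = 0`: the typed factor vanishes);
* `stubBoxDilation_at_iff_jac`: stub A at fixed `m` is the member `(c,k) = (m², m−1)` of the Jacobian
  family `DilationMoveJac 2 m`, whose factor is forced (`dilationMoveJac_iff_of`);
* `stubPolarPartLevelSix_false_at_oneSubX6`: the hypothesis `R.natDegree < 6` of stub C
  (`stub_polarPartLevelSix`) is tight — at `R = 1 − X⁶` no `(b, c)` exists (conditional on the route's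
  rigidity inputs `RigidityInput I₁ I₂`);
* `stubPolynomialPart_constant_forced`: the constant `Σ_k Q_k/(k+1)²` of stub B
  (`stub_polynomialPartByJacobians`) is the only admissible one (test `Q = 1`; conditional on
  `RigidityInput`).
[Kontsevich–Zagier 2001 §1.2; Calegari–Dimitrov–Tang 2024 Thm 1]
-/

namespace Summit.KontsevichZagierPeriods.HurwitzMicroSectors.ReductionTwoSixNegative

open MeasureTheory Set
open Literature.NumberTheory.Transcendental
open Summit.KontsevichZagierPeriods.KontsevichZagierPeriods.Theses.HurwitzMicroSectors
open Summit.KontsevichZagierPeriods.HurwitzMicroSectors.DilationMoveNegative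

noncomputable section

namespace DrefuteMutation

/-- MUTATION A1: stub A (`stub_boxDilation`) with the hypothesis `1 ≤ m` DELETED (everything else
verbatim) is FALSE — at `m = 0` the typed factor `0² · ∏ xᵢ^(0-1)` vanishes, so `r = 0`, `r' = 1` on
the box would be "one move" with values `0 ≠ 1`. -/
theorem stubBoxDilation_false_without_oneLe :
    ¬ ∀ (m : ℕ) (r r' : KZ.IntegralRep 2), r.domain = {x | ∀ i, x i ∈ Set.Ioo (0:ℝ) 1} →
      r'.domain = {x | ∀ i, x i ∈ Set.Ioo (0:ℝ) 1} →
      (∀ x ∈ r.domain, r.integrand x = r'.integrand (fun i => x i ^ m) * ((m : ℝ) ^ 2 * ∏ i, x i ^ (m - 1))) →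
      KZ.of r - KZ.of r' ∈ KZ.changeOfVariablesRel := by
  intro h
  refine not_dilationMoveJac_zero_exp (n := 2) (by norm_num) 0 0 ?_
  intro r r' hr hr' hrel
  exact h 0 r r' hr hr' (fun x hx => by simpa using hrel x hx)

/-- Stub A at fixed `m` is the member `(c, k) = (m², m − 1)` of the Jacobian family of
`DilationMove/Negative/LoadBearing`; so (given the crux `DilationMove`) its factor is the UNIQUE valid
monomial factor (`dilationMoveJac_iff_of`): e.g. `2·xy` at `m = 2` is NOT a move
(`not_dilationMoveJac_two_two_linear`). -/
theorem stubBoxDilation_at_iff_jac (m : ℕ) :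
    (∀ (r r' : KZ.IntegralRep 2), r.domain = {x | ∀ i, x i ∈ Set.Ioo (0:ℝ) 1} →
      r'.domain = {x | ∀ i, x i ∈ Set.Ioo (0:ℝ) 1} →
      (∀ x ∈ r.domain, r.integrand x = r'.integrand (fun i => x i ^ m) * ((m : ℝ) ^ 2 * ∏ i, x i ^ (m - 1))) →
      KZ.of r - KZ.of r' ∈ KZ.changeOfVariablesRel) ↔ DilationMoveJac 2 m ((m : ℚ) ^ 2) (m - 1) := by
  simp only [DilationMoveJac, Rat.cast_pow, Rat.cast_natCast]

variable {I₁ I₂ : ℝ}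

open Polynomial in
/-- MUTATION C1 (conditional on the route's rigidity inputs `RigidityInput I₁ I₂` =
`BoxIntegralZetaTwo ∧ BoxIntegralLTwoChiThree ∧ CDT`): the hypothesis `R.natDegree < 6` of stub C
(`stub_polarPartLevelSix`) is load-bearing and TIGHT — at `R = 1 − X⁶` (natDegree `6`, sector
integrand `1`) no `(b, c)` works, since `1 ∉ ℚ·I₁ + ℚ·I₂`. -/
theorem stubPolarPartLevelSix_false_at_oneSubX6 (h : RigidityInput I₁ I₂) :
    ¬ ∃ b c : ℚ, ∀ (r r' : KZ.IntegralRep 2), r.domain = {x | ∀ i, x i ∈ Set.Ioo (0:ℝ) 1} →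
      r'.domain = {x | ∀ i, x i ∈ Set.Ioo (0:ℝ) 1} →
      Set.EqOn r.integrand (fun x => Polynomial.aeval (x 0 * x 1) (C (1:ℚ) * (1 - X ^ 6)) /
        (1 - (x 0 * x 1) ^ 6)) r.domain →
      Set.EqOn r'.integrand
        (fun x => (b : ℝ) / (1 - x 0 * x 1) + c / (1 + x 0 * x 1 + (x 0 * x 1) ^ 2)) r'.domain →
      KZ.Equivalent r r' := by
  rintro ⟨b, c, H⟩
  have heqv := H (nfRep h 1 0 0) (nfRep h 0 b c) rfl rfl (eqOn_const_witness 1)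
    (fun x _ => by simp [nf])
  obtain ⟨ha, -, -⟩ :=
    coeff_eq_of_equivalent h (nfRep h 1 0 0) (nfRep h 0 b c) rfl (fun _ _ => rfl) rfl
      (fun _ _ => rfl) heqv
  exact one_ne_zero ha

open Polynomial in
/-- MUTATION B1 (conditional on `RigidityInput`): in stub B (`stub_polynomialPartByJacobians`) the
constant `Σ_k Q_k/(k+1)²` is FORCED — any other rational constant `a'` fails already at `Q = 1`
(values `1 ≠ a'`). So the stub's conclusion cannot be mis-normalised (e.g. `Σ Q_k/(k+1)` — the
one-dimensional `∫₀¹ t^k` — would be false at `Q = X`: `1/4 ≠ 1/2`). -/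
theorem stubPolynomialPart_constant_forced (h : RigidityInput I₁ I₂) {a' : ℚ}
    (H : ∀ (r r' : KZ.IntegralRep 2), r.domain = {x | ∀ i, x i ∈ Set.Ioo (0:ℝ) 1} →
      r'.domain = {x | ∀ i, x i ∈ Set.Ioo (0:ℝ) 1} →
      Set.EqOn r.integrand (fun x => Polynomial.aeval (x 0 * x 1) (1 : ℚ[X])) r.domain →
      Set.EqOn r'.integrand (fun _ => ((a' : ℚ) : ℝ)) r'.domain → KZ.Equivalent r r') :
    a' = 1 := by
  have heqv := H (nfRep h 1 0 0) (nfRep h a' 0 0) rfl rfl (fun x _ => by simp [nf])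
    (fun x _ => by simp [nf])
  obtain ⟨ha, -, -⟩ :=
    coeff_eq_of_equivalent h (nfRep h 1 0 0) (nfRep h a' 0 0) rfl (fun _ _ => rfl) rfl
      (fun _ _ => rfl) heqv
  exact ha.symm

end DrefuteMutation

end

end Summit.KontsevichZagierPeriods.HurwitzMicroSectors.ReductionTwoSixNegative
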